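import Summits.CriticalPhenomena.PercolationContinuityZ3.Theorems.PercNearOneGluingNoHeavyLowerTailSunflowerTBernScheme
import HarnessLib

/-!
# `NoHeavyLowerTail` (crux stmt-CriticalPhenomena-4575), abstract sunflower cubic: GRADED T-BERN — the elementary LAST STEP
# (state + last petal + phantom block), by convexity in `ρ = γ_r/α_r`

Support file (seat `prim-ineq-prove-1` gen 69; `--supports stmt-CriticalPhenomena-4575`).  No `sorry`, no named facts, no
definitions.  Memo: run/shared/lean/prim/prim-ineq-prove-1/FINDING-GRADED-prove1-g69.md §2.

THE LAST STEP OF THE GRADED T-BERN CERTIFICATE.  In normalised coordinates (floors `(1,1)`, `ᾱ = 1/A₀`) the sequential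
scheme leaves a state `(A′, G′)` — `∏_{F₀}(α_jX + γ_j) ≤_coef (X+1)^(|F₀|−1)(A′X + G′)` with `G′ = ∏γ_j ≥ 1` exact and
`A′ ≤ α(∏x_j)` — a last γ-heavy petal `r = (α_r, γ_r)` (`1 ≤ α_r ≤ γ_r`, and `g_r ≤ A_r`, i.e. `a₀γ_r ≤ A₀α_r`) and the
phantom block `(ᾱX + x/a₀)` with `ĝ·x ≤ 1`, `ĝ := G′γ_r`, `x ≥ a₀`.  The target is `(X+1)(ᾱX+1)(ᾱX+1/a₀)`.  Writing
`Σ = A′γ_r + G′α_r ≤ ᾱρ + ĝ/ρ` with `ρ := γ_r/α_r ∈ [1, min(ĝ, A₀/a₀)]` (from `A′α_r ≤ ᾱ`), the two middle coefficient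
conditions — the (C1′), (C2′) of memo FINDING-EDGE-prove1-g68 §6c — become a concave resp. a convex quadratic inequality in
`ρ` whose endpoint values at `ρ ∈ {1, ĝ, A₀/a₀}` FACTOR with the right sign (`quadX1_nonneg`, `quadX2_nonneg`); no (HC)-type
machinery is needed.  **`coefDom_final_r`** is the assembled cubic domination; **`coefDom_final0`** the version without a last
petal (state + phantom against `(ᾱX+1)(ᾱX+1/a₀)`).
-/

noncomputable section

namespace Summit.CriticalPhenomena.PercolationContinuityZ3.Theorems.SunflowerPartition

namespace SafeCalc

namespace LinkedCurrency

open Finset Polynomial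

/-! ## Cubics -/

/-- The coefficients of a cubic `C p₃ X³ + C p₂ X² + C p₁ X + C p₀`. [this work] -/
theorem coeff_cubic (p3 p2 p1 p0 : ℝ) (k : ℕ) :
    (C p3 * X ^ 3 + C p2 * X ^ 2 + C p1 * X + C p0).coeff k =
      if k = 3 then p3 else if k = 2 then p2 else if k = 1 then p1 else if k = 0 then p0 else 0 := by
  rw [coeff_add, coeff_add, coeff_add, coeff_C_mul, coeff_X_pow, coeff_C_mul, coeff_X_pow, coeff_C_mul, coeff_X, coeff_C]
  rcases k with _ | _ | _ | _ | k
  · simp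
  · simp
  · simp
  · simp
  · simp

/-- Domination of cubics is domination of the four coefficients. [this work] -/
theorem coefDom_cubic {p3 p2 p1 p0 q3 q2 q1 q0 : ℝ} (h3 : p3 ≤ q3) (h2 : p2 ≤ q2) (h1 : p1 ≤ q1) (h0 : p0 ≤ q0) :
    CoefDom (C p3 * X ^ 3 + C p2 * X ^ 2 + C p1 * X + C p0) (C q3 * X ^ 3 + C q2 * X ^ 2 + C q1 * X + C q0) := by
  intro k
  rw [coeff_cubic, coeff_cubic]
  split_ifs <;> first | exact h3 | exact h2 | exact h1 | exact h0 | exact le_rfl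

/-- The product of three linear polynomials as an explicit cubic. [this work] -/
theorem lin3_eq (A G a c e f : ℝ) :
    (C A * X + C G) * (C a * X + C c) * (C e * X + C f) =
      C (A * a * e) * X ^ 3 + C (A * a * f + (A * c + G * a) * e) * X ^ 2 + C ((A * c + G * a) * f + G * c * e) * X +
        C (G * c * f) := by
  simp only [C_mul, C_add]
  ring

/-- The product of two linear polynomials as an explicit cubic with vanishing top coefficient. [this work] -/
theorem lin2_eq_cubic (A G e f : ℝ) :
    (C A * X + C G) * (C e * X + C f) = C 0 * X ^ 3 + C (A * e) * X ^ 2 + C (A * f + G * e) * X + C (G * f) := by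
  simp only [C_mul, C_add, C_0]
  ring

/-! ## The two quadratic inequalities in `ρ` -/

/-- **The `X¹`-inequality**: for `1 ≤ ρ ≤ ĝ`, `a₀ρ ≤ A₀`, `a₀ĝ ≤ 1`, `0 < a₀`:
`ρ² + A₀ĝ + a₀ĝ²ρ ≤ (1 + A₀ + a₀)·ρĝ` (a concave quadratic in `ρ`, nonnegative at the endpoints `1` and `min(ĝ, A₀/a₀)`).
[this work] -/
theorem quadX1_nonneg {ρ gh A₀ a₀ : ℝ} (ha₀ : 0 < a₀) (hρ1 : 1 ≤ ρ) (hρg : ρ ≤ gh) (hρc : a₀ * ρ ≤ A₀) (hg1 : a₀ * gh ≤ 1) :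
    ρ ^ 2 + A₀ * gh + a₀ * gh ^ 2 * ρ ≤ (1 + A₀ + a₀) * (ρ * gh) := by
  have hgh1 : 1 ≤ gh := hρ1.trans hρg
  rcases le_or_gt (a₀ * gh) A₀ with hcase | hcase
  · -- endpoints `1` and `ĝ`
    have key : (gh - 1) * ((1 + A₀ + a₀) * (ρ * gh) - (ρ ^ 2 + A₀ * gh + a₀ * gh ^ 2 * ρ)) =
        (gh - ρ) * ((gh - 1) * (1 - a₀ * gh)) + (ρ - 1) * (gh * (gh - 1) * (A₀ - a₀ * gh)) +
          (ρ - 1) * (gh - ρ) * (gh - 1) := by ring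
    have h1 : 0 ≤ (gh - ρ) * ((gh - 1) * (1 - a₀ * gh)) :=
      mul_nonneg (sub_nonneg.2 hρg) (mul_nonneg (sub_nonneg.2 hgh1) (sub_nonneg.2 hg1))
    have h2 : 0 ≤ (ρ - 1) * (gh * (gh - 1) * (A₀ - a₀ * gh)) :=
      mul_nonneg (sub_nonneg.2 hρ1) (mul_nonneg (mul_nonneg (by linarith) (sub_nonneg.2 hgh1)) (sub_nonneg.2 hcase))
    have h3 : 0 ≤ (ρ - 1) * (gh - ρ) * (gh - 1) :=
      mul_nonneg (mul_nonneg (sub_nonneg.2 hρ1) (sub_nonneg.2 hρg)) (sub_nonneg.2 hgh1)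
    rcases eq_or_lt_of_le hgh1 with hgh | hgh
    · -- `ĝ = 1`, hence `ρ = 1`
      have hρ : ρ = 1 := le_antisymm (by rw [hgh]; exact hρg) hρ1
      rw [hρ, ← hgh]; nlinarith [mul_nonneg (mul_nonneg ha₀.le (sub_nonneg.2 hgh1)) (sub_nonneg.2 hg1)]
    · have hpos : 0 < gh - 1 := sub_pos.2 hgh
      have : 0 ≤ (gh - 1) * ((1 + A₀ + a₀) * (ρ * gh) - (ρ ^ 2 + A₀ * gh + a₀ * gh ^ 2 * ρ)) := by
        rw [key]; linarith
      nlinarith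
  · -- endpoints `1` and `c = A₀/a₀ ≤ ĝ`
    set c := A₀ / a₀ with hc
    have hA : A₀ = a₀ * c := by rw [hc]; field_simp
    have haA : a₀ ≤ A₀ := by nlinarith
    have hc1 : 1 ≤ c := by rw [hc, le_div_iff₀ ha₀]; linarith
    have hρc' : ρ ≤ c := by rw [hc, le_div_iff₀ ha₀]; linarith
    have hcg : c ≤ gh := by rw [hc, div_le_iff₀ ha₀]; linarith
    rw [hA]
    have key : (c - 1) * ((1 + a₀ * c + a₀) * (ρ * gh) - (ρ ^ 2 + a₀ * c * gh + a₀ * gh ^ 2 * ρ)) =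
        (c - ρ) * ((gh - 1) * (1 - a₀ * gh)) + (ρ - 1) * (c * (gh - c) * (1 - a₀ * gh)) +
          (ρ - 1) * (c - ρ) * (c - 1) := by ring
    have h1 : 0 ≤ (c - ρ) * ((gh - 1) * (1 - a₀ * gh)) :=
      mul_nonneg (sub_nonneg.2 hρc') (mul_nonneg (sub_nonneg.2 hgh1) (sub_nonneg.2 hg1))
    have h2 : 0 ≤ (ρ - 1) * (c * (gh - c) * (1 - a₀ * gh)) :=
      mul_nonneg (sub_nonneg.2 hρ1) (mul_nonneg (mul_nonneg (by linarith) (sub_nonneg.2 hcg)) (sub_nonneg.2 hg1))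
    have h3 : 0 ≤ (ρ - 1) * (c - ρ) * (c - 1) :=
      mul_nonneg (mul_nonneg (sub_nonneg.2 hρ1) (sub_nonneg.2 hρc')) (sub_nonneg.2 hc1)
    rcases eq_or_lt_of_le hc1 with hc1' | hc1'
    · have hρ : ρ = 1 := le_antisymm (by rw [hc1']; exact hρc') hρ1
      rw [hρ, ← hc1']; nlinarith [mul_nonneg (mul_nonneg ha₀.le (sub_nonneg.2 hgh1)) (sub_nonneg.2 hg1)]
    · have hpos : 0 < c - 1 := sub_pos.2 hc1'
      have : 0 ≤ (c - 1) * ((1 + a₀ * c + a₀) * (ρ * gh) - (ρ ^ 2 + a₀ * c * gh + a₀ * gh ^ 2 * ρ)) := by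
        rw [key]; linarith
      nlinarith

/-- **The `X²`-inequality**: for `1 ≤ ρ ≤ ĝ`, `a₀ρ ≤ A₀`, `a₀ĝ ≤ 1`, `0 < a₀`, `0 ≤ A₀`:
`A₀ρ + a₀ĝρ² + a₀A₀ĝ² ≤ ((1 + a₀)A₀ + a₀)·ρĝ`. [this work] -/
theorem quadX2_nonneg {ρ gh A₀ a₀ : ℝ} (ha₀ : 0 < a₀) (hA₀ : 0 ≤ A₀) (hρ1 : 1 ≤ ρ) (hρg : ρ ≤ gh) (hρc : a₀ * ρ ≤ A₀)
    (hg1 : a₀ * gh ≤ 1) :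
    A₀ * ρ + a₀ * gh * ρ ^ 2 + a₀ * A₀ * gh ^ 2 ≤ ((1 + a₀) * A₀ + a₀) * (ρ * gh) := by
  have hgh1 : 1 ≤ gh := hρ1.trans hρg
  rcases le_or_gt (a₀ * gh) A₀ with hcase | hcase
  · have key : (gh - 1) * (((1 + a₀) * A₀ + a₀) * (ρ * gh) - (A₀ * ρ + a₀ * gh * ρ ^ 2 + a₀ * A₀ * gh ^ 2)) =
        (gh - ρ) * (A₀ * (gh - 1) * (1 - a₀ * gh)) + (ρ - 1) * (gh * (gh - 1) * (A₀ - a₀ * gh)) +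
          a₀ * gh * ((ρ - 1) * (gh - ρ) * (gh - 1)) := by ring
    have h1 : 0 ≤ (gh - ρ) * (A₀ * (gh - 1) * (1 - a₀ * gh)) :=
      mul_nonneg (sub_nonneg.2 hρg) (mul_nonneg (mul_nonneg hA₀ (sub_nonneg.2 hgh1)) (sub_nonneg.2 hg1))
    have h2 : 0 ≤ (ρ - 1) * (gh * (gh - 1) * (A₀ - a₀ * gh)) :=
      mul_nonneg (sub_nonneg.2 hρ1) (mul_nonneg (mul_nonneg (by linarith) (sub_nonneg.2 hgh1)) (sub_nonneg.2 hcase))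
    have h3 : 0 ≤ a₀ * gh * ((ρ - 1) * (gh - ρ) * (gh - 1)) :=
      mul_nonneg (mul_nonneg ha₀.le (by linarith))
        (mul_nonneg (mul_nonneg (sub_nonneg.2 hρ1) (sub_nonneg.2 hρg)) (sub_nonneg.2 hgh1))
    rcases eq_or_lt_of_le hgh1 with hgh | hgh
    · have hρ : ρ = 1 := le_antisymm (by rw [hgh]; exact hρg) hρ1
      rw [hρ, ← hgh]; nlinarith [mul_nonneg (mul_nonneg ha₀.le (sub_nonneg.2 hgh1)) (sub_nonneg.2 hg1)]
    · have hpos : 0 < gh - 1 := sub_pos.2 hgh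
      have : 0 ≤ (gh - 1) * (((1 + a₀) * A₀ + a₀) * (ρ * gh) - (A₀ * ρ + a₀ * gh * ρ ^ 2 + a₀ * A₀ * gh ^ 2)) := by
        rw [key]; linarith
      nlinarith
  · set c := A₀ / a₀ with hc
    have hA : A₀ = a₀ * c := by rw [hc]; field_simp
    have haA : a₀ ≤ A₀ := by nlinarith
    have hc1 : 1 ≤ c := by rw [hc, le_div_iff₀ ha₀]; linarith
    have hρc' : ρ ≤ c := by rw [hc, le_div_iff₀ ha₀]; linarith
    have hcg : c ≤ gh := by rw [hc, div_le_iff₀ ha₀]; linarith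
    rw [hA]
    have key : (c - 1) * (((1 + a₀) * (a₀ * c) + a₀) * (ρ * gh) - (a₀ * c * ρ + a₀ * gh * ρ ^ 2 + a₀ * (a₀ * c) * gh ^ 2)) =
        (c - ρ) * (a₀ * c * (gh - 1) * (1 - a₀ * gh)) + (ρ - 1) * (a₀ * c * (gh - c) * (1 - a₀ * gh)) +
          a₀ * gh * ((ρ - 1) * (c - ρ) * (c - 1)) := by ring
    have hc0 : 0 ≤ c := zero_le_one.trans hc1
    have h1 : 0 ≤ (c - ρ) * (a₀ * c * (gh - 1) * (1 - a₀ * gh)) :=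
      mul_nonneg (sub_nonneg.2 hρc')
        (mul_nonneg (mul_nonneg (mul_nonneg ha₀.le hc0) (sub_nonneg.2 hgh1)) (sub_nonneg.2 hg1))
    have h2 : 0 ≤ (ρ - 1) * (a₀ * c * (gh - c) * (1 - a₀ * gh)) :=
      mul_nonneg (sub_nonneg.2 hρ1)
        (mul_nonneg (mul_nonneg (mul_nonneg ha₀.le hc0) (sub_nonneg.2 hcg)) (sub_nonneg.2 hg1))
    have h3 : 0 ≤ a₀ * gh * ((ρ - 1) * (c - ρ) * (c - 1)) :=
      mul_nonneg (mul_nonneg ha₀.le (by linarith))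
        (mul_nonneg (mul_nonneg (sub_nonneg.2 hρ1) (sub_nonneg.2 hρc')) (sub_nonneg.2 hc1))
    rcases eq_or_lt_of_le hc1 with hc1' | hc1'
    · have hρ : ρ = 1 := le_antisymm (by rw [hc1']; exact hρc') hρ1
      rw [hρ, ← hc1']; nlinarith [mul_nonneg (mul_nonneg ha₀.le (sub_nonneg.2 hgh1)) (sub_nonneg.2 hg1)]
    · have hpos : 0 < c - 1 := sub_pos.2 hc1'
      have : 0 ≤ (c - 1) * (((1 + a₀) * (a₀ * c) + a₀) * (ρ * gh) -
          (a₀ * c * ρ + a₀ * gh * ρ ^ 2 + a₀ * (a₀ * c) * gh ^ 2)) := by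
        rw [key]; linarith
      nlinarith

/-! ## The last step -/

/-- **THE LAST STEP (state + last γ-heavy petal + phantom block).**  Normalised floors; `0 < a₀ ≤ A₀`; state `(A′, G′)` with
`0 ≤ A′`, `A′·α_r ≤ 1/A₀`, `1 ≤ G′`; last petal `1 ≤ α_r ≤ γ_r` with `a₀γ_r ≤ A₀α_r` (`g_r ≤ A_r`); phantom `x ≥ a₀` with the
tightened block budget `G′γ_r·x ≤ 1`.  Then
`(A′X + G′)(α_rX + γ_r)((1/A₀)X + x/a₀) ≤_coef (X + 1)·((1/A₀)X + 1)·((1/A₀)X + 1/a₀)`. [this work] -/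
theorem coefDom_final_r {A₀ a₀ A' G' αr γr x : ℝ} (ha₀ : 0 < a₀) (haA : a₀ ≤ A₀) (hA'0 : 0 ≤ A')
    (hA'a : A' * αr ≤ 1 / A₀) (hG' : 1 ≤ G') (hαr : 1 ≤ αr) (hαγ : αr ≤ γr) (hγA : a₀ * γr ≤ A₀ * αr) (hax : a₀ ≤ x)
    (hbud : G' * γr * x ≤ 1) :
    CoefDom ((C A' * X + C G') * (C αr * X + C γr) * (C (1 / A₀) * X + C (x / a₀)))
      ((C 1 * X + C 1) * ((C (1 / A₀) * X + C 1) * (C (1 / A₀) * X + C (1 / a₀)))) := by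
  have hA₀ : 0 < A₀ := ha₀.trans_le haA
  have hαr0 : 0 < αr := zero_lt_one.trans_le hαr
  have hγr0 : 0 < γr := hαr0.trans_le hαγ
  have hx0 : 0 < x := ha₀.trans_le hax
  have hG'0 : 0 ≤ G' := zero_le_one.trans hG'
  set ρ := γr / αr with hρ
  set gh := G' * γr with hgh
  have hρ1 : 1 ≤ ρ := by rw [hρ, one_le_div hαr0]; exact hαγ
  have hργ : ρ ≤ γr := div_le_self hγr0.le hαr
  have hγgh : γr ≤ gh := by rw [hgh]; nlinarith
  have hρg : ρ ≤ gh := hργ.trans hγgh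
  have hρc : a₀ * ρ ≤ A₀ := by
    rw [hρ, ← mul_div_assoc, div_le_iff₀ hαr0]; exact hγA
  have hg1 : a₀ * gh ≤ 1 := by rw [hgh]; nlinarith
  have hgh0 : 0 < gh := by rw [hgh]; nlinarith
  have hρ0 : 0 < ρ := zero_lt_one.trans_le hρ1
  -- Σ ≤ ρ/A₀ + ĝ/ρ, x ≤ 1/ĝ
  have hAγ : A₀ * (A' * γr) ≤ ρ := by
    have h1 : A' * γr = A' * αr * ρ := by rw [hρ]; field_simp
    rw [h1, ← mul_assoc]
    have h2 : A₀ * (A' * αr) ≤ 1 := by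
      have := mul_le_mul_of_nonneg_left hA'a hA₀.le
      rwa [mul_one_div_cancel hA₀.ne'] at this
    nlinarith
  have hGα : G' * αr * ρ = gh := by rw [hgh, hρ]; field_simp
  have hxg : x * gh ≤ 1 := by rw [hgh]; linarith
  have hS0 : 0 ≤ A' * γr + G' * αr := by positivity
  -- the two scalar inequalities
  have hX1 : A₀ * (A' * γr + G' * αr) * x + a₀ * gh ≤ A₀ + 1 + a₀ := by
    have key := quadX1_nonneg ha₀ hρ1 hρg hρc hg1
    -- `A₀Σx·ρĝ ≤ (ρ + A₀ĝ/ρ·ρ)·xĝ ≤ ρ² ... `: multiply the claim by `ρ·ĝ > 0`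
    have h1 : A₀ * (A' * γr + G' * αr) * ρ ≤ ρ * ρ + A₀ * gh := by nlinarith
    have h2 : (A₀ * (A' * γr + G' * αr) * x) * (ρ * gh) ≤ ρ * ρ + A₀ * gh := by
      calc (A₀ * (A' * γr + G' * αr) * x) * (ρ * gh) = (A₀ * (A' * γr + G' * αr) * ρ) * (x * gh) := by ring
        _ ≤ (ρ * ρ + A₀ * gh) * (x * gh) :=
            mul_le_mul_of_nonneg_right h1 (mul_nonneg hx0.le hgh0.le)
        _ ≤ (ρ * ρ + A₀ * gh) * 1 := mul_le_mul_of_nonneg_left hxg (by positivity)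
        _ = ρ * ρ + A₀ * gh := mul_one _
    have h3 : (A₀ * (A' * γr + G' * αr) * x + a₀ * gh) * (ρ * gh) ≤ (A₀ + 1 + a₀) * (ρ * gh) := by nlinarith
    exact le_of_mul_le_mul_right h3 (mul_pos hρ0 hgh0)
  have hX2 : A₀ * (A₀ * (A' * αr) * x) + A₀ * a₀ * (A' * γr + G' * αr) ≤ A₀ + A₀ * a₀ + a₀ := by
    have key := quadX2_nonneg ha₀ hA₀.le hρ1 hρg hρc hg1
    have hAα : A₀ * (A' * αr) ≤ 1 := by
      have := mul_le_mul_of_nonneg_left hA'a hA₀.le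
      rwa [mul_one_div_cancel hA₀.ne'] at this
    have h1 : A₀ * (A₀ * (A' * αr) * x) * (ρ * gh) ≤ A₀ * ρ := by
      have h11 : A₀ * (A' * αr) * (x * gh) ≤ 1 * 1 := mul_le_mul hAα hxg (by positivity) zero_le_one
      have e : A₀ * (A₀ * (A' * αr) * x) * (ρ * gh) = A₀ * ρ * (A₀ * (A' * αr) * (x * gh)) := by ring
      rw [e]
      have := mul_le_mul_of_nonneg_left h11 (mul_nonneg hA₀.le hρ0.le)
      simpa using this
    have h2 : A₀ * a₀ * (A' * γr + G' * αr) * (ρ * gh) ≤ a₀ * gh * ρ ^ 2 + a₀ * A₀ * gh ^ 2 := by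
      have e : A₀ * a₀ * (A' * γr + G' * αr) * (ρ * gh) =
          a₀ * gh * ρ * (A₀ * (A' * γr)) + A₀ * a₀ * gh * (G' * αr * ρ) := by ring
      rw [e, hGα]
      have := mul_le_mul_of_nonneg_left hAγ (show 0 ≤ a₀ * gh * ρ by positivity)
      nlinarith
    have h3 : (A₀ * (A₀ * (A' * αr) * x) + A₀ * a₀ * (A' * γr + G' * αr)) * (ρ * gh) ≤
        (A₀ + A₀ * a₀ + a₀) * (ρ * gh) := by nlinarith
    exact le_of_mul_le_mul_right h3 (mul_pos hρ0 hgh0)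
  -- the target cubic
  rw [lin3_eq, show (C (1 : ℝ) * X + C 1) * ((C (1 / A₀) * X + C 1) * (C (1 / A₀) * X + C (1 / a₀))) =
      (C 1 * X + C 1) * (C (1 / A₀) * X + C 1) * (C (1 / A₀) * X + C (1 / a₀)) by ring, lin3_eq]
  refine coefDom_cubic ?_ ?_ ?_ ?_
  · -- X³
    have : A' * αr * (1 / A₀) ≤ 1 / A₀ * (1 / A₀) := mul_le_mul_of_nonneg_right hA'a (by positivity)
    simpa using this
  · -- X²
    have eL : A' * αr * (x / a₀) + (A' * γr + G' * αr) * (1 / A₀) =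
        (A₀ * (A₀ * (A' * αr) * x) + A₀ * a₀ * (A' * γr + G' * αr)) / (A₀ ^ 2 * a₀) := by
      field_simp
    have eR : 1 * (1 / A₀) * (1 / a₀) + (1 * 1 + 1 * (1 / A₀)) * (1 / A₀) = (A₀ + A₀ * a₀ + a₀) / (A₀ ^ 2 * a₀) := by
      field_simp; ring
    rw [eL, eR]
    exact div_le_div_of_nonneg_right hX2 (by positivity)
  · -- X¹
    have eL : (A' * γr + G' * αr) * (x / a₀) + G' * γr * (1 / A₀) =
        (A₀ * (A' * γr + G' * αr) * x + a₀ * gh) / (A₀ * a₀) := by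
      rw [hgh]; field_simp
    have eR : (1 * 1 + 1 * (1 / A₀)) * (1 / a₀) + 1 * 1 * (1 / A₀) = (A₀ + 1 + a₀) / (A₀ * a₀) := by
      field_simp
    rw [eL, eR]
    exact div_le_div_of_nonneg_right hX1 (by positivity)
  · -- X⁰
    have : G' * γr * (x / a₀) ≤ 1 * 1 * (1 / a₀) := by
      rw [one_mul, one_mul, ← mul_div_assoc]
      exact div_le_div_of_nonneg_right hbud ha₀.le
    exact this

/-- **THE LAST STEP WITHOUT A LAST PETAL (state + phantom block).**  `0 < a₀`, `0 < A₀`; state `A′ ≤ 1/A₀`, `a₀G′ ≤ 1`;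
phantom `0 ≤ x ≤ 1` with `G′x ≤ 1`.  Then `(A′X + G′)((1/A₀)X + x/a₀) ≤_coef ((1/A₀)X + 1)((1/A₀)X + 1/a₀)`.
[this work] -/
theorem coefDom_final0 {A₀ a₀ A' G' x : ℝ} (ha₀ : 0 < a₀) (hA₀ : 0 < A₀) (hA' : A' ≤ 1 / A₀)
    (hG'a : a₀ * G' ≤ 1) (hx0 : 0 ≤ x) (hx1 : x ≤ 1) (hbud : G' * x ≤ 1) :
    CoefDom ((C A' * X + C G') * (C (1 / A₀) * X + C (x / a₀))) ((C (1 / A₀) * X + C 1) * (C (1 / A₀) * X + C (1 / a₀))) := by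
  rw [lin2_eq_cubic, lin2_eq_cubic]
  refine coefDom_cubic le_rfl ?_ ?_ ?_
  · exact mul_le_mul_of_nonneg_right hA' (by positivity)
  · -- `A′x/a₀ + G′/A₀ ≤ 1/a₀ + 1/A₀`: `x + a₀G′ ≤ 1 + a₀` from `(1−x)(1−a₀G′) ≥ 0` and `G′x ≤ 1`
    have h1 : x + a₀ * G' ≤ 1 + a₀ := by nlinarith [mul_nonneg (sub_nonneg.2 hx1) (sub_nonneg.2 hG'a)]
    have h2 : A₀ * A' ≤ 1 := by
      have := mul_le_mul_of_nonneg_left hA' hA₀.le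
      rwa [mul_one_div_cancel hA₀.ne'] at this
    have main : A₀ * A' * x + a₀ * G' ≤ 1 + a₀ := by nlinarith
    have eL : A' * (x / a₀) + G' * (1 / A₀) = (A₀ * A' * x + a₀ * G') / (A₀ * a₀) := by field_simp
    have eR : 1 / A₀ * (1 / a₀) + 1 * (1 / A₀) = (1 + a₀) / (A₀ * a₀) := by field_simp
    rw [eL, eR]
    exact div_le_div_of_nonneg_right main (by positivity)
  · have : G' * (x / a₀) ≤ 1 * (1 / a₀) := by
      rw [one_mul, ← mul_div_assoc]
      exact div_le_div_of_nonneg_right hbud ha₀.le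
    exact this

end LinkedCurrency

end SafeCalc

end Summit.CriticalPhenomena.PercolationContinuityZ3.Theorems.SunflowerPartition
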